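import Summits.Ventures.PercRepro.RankLevelSetLevelFiveCqSixteenModulo
import Summits.Ventures.PercRepro.S2FifteenFifteen

/-!
# PercRepro — S2: THE `p = 15` ROW — WHAT IS OPEN, AS ONE HYPOTHESIS (p7, gen 11; sub-claim S2)

With the cell `(15, 15)` a tree theorem (S2FifteenFifteen, the nested dichotomy), the «16» assembly needs only the TEN cells
`(15, 6 … 14)` and `(15, 16)`: **`c025_five_large_sharp16_of_ten_cells`** — C-025 at level `5` for every `p ≥ 16` from
`RLS M 15 5` on the `e`-free cores of rank `15` and corank `d ∈ {6, …, 14, 16}`. The ten are priced OPEN with the kit's levers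
(lean-drafts/p7/g11/mining/price15.py, flatcount2.py, chain15.py): plain cells `1.22 / 1.38 / 1.50 / 1.37 / 1.44 / 1.22 / 1.28 / 1.13 / 1.20 / 1.04`
at `d = 6 … 14, 16`; the nested dichotomy fails at the concentrated cases (e.g. `(15, 8)`: `ν = 6` on `≤ 11` points, `114,081 > 111,821`);
with p1's `Q*(7) = 19` four-circuit chain, the flat count of the concentrated case and the sharpened coloop step (the dropped terms
`#{ρ' = p − 1}` and `#{ρ' = 5}` of a coloop deletion are each `≥ #U`) the cells `(15, 8)` and `(15, 9)` close on paper (not typed), the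
other eight stay open by `1.03 … 1.19`. Nothing here asserts a window move. Axioms: standard.
-/

open scoped Matroid

namespace PercRepro

namespace ThmN

open Set

variable {α : Type}

/-- **THEOREM C₅ AT `16` MODULO THE TEN OPEN CELLS** `(15, 6 … 14)`, `(15, 16)`: the cell `(15, 15)` is S2FifteenFifteen. -/
theorem c025_five_large_sharp16_of_ten_cells
    (hten : ∀ (M : Matroid α) [M.Finite] (d : ℕ), 6 ≤ d → d ≤ 16 → d ≠ 15 → M.eRank = ((15 : ℕ) : ℕ∞) →
      M.E.ncard = 15 + d →
      (∀ e ∈ M.E, ∃ A ⊆ M.E \ {e}, e ∉ M.closure A ∧ e ∉ M.closure ((M.E \ {e}) \ A)) → RLS M 15 5)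
    (M : Matroid α) [M.Finite] (p : ℕ) (hp : 16 ≤ p) : RLS M p 5 := by
  refine c025_five_large_sharp16_of_small_cells ?_ M p hp
  intro M _ d hd6 hd16 hR hn hfree
  by_cases h15 : d = 15
  · subst h15
    exact c025_fifteen_fifteen M hR hn hfree
  · exact hten M d hd6 hd16 h15 hR hn hfree

end ThmN

end PercRepro
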